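import Literature.NumberTheory.Automorphic.ChevalleyGroupLie
import Literature.NumberTheory.Automorphic.BurnsideKolchin
import HarnessLib

/-!
# `G = ⟨T_X, exp (x E_α)⟩` is connected reductive with maximal torus `T_X` and roots `R`
(Springer 10.2.8)

Trunk T-AUTOMORPHIC (G25 AutomorphicL); the group-theoretic half of Chevalley's existence theorem
(`Literature.NumberTheory.Automorphic.chevalley_existence`, Springer, *Linear Algebraic Groups*,
2nd ed., 10.1.1), step 3. For the infinitesimal data `D : RootRep k P b J mb`
(`ChevalleyGroupData.lean`) and its group `D.G = ⟨T, U_α⟩` (`ChevalleyGroupBasic.lean`), over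
an algebraically closed field of characteristic `0`, we prove (Springer 10.2.8:
*"`G` is reductive and `T` is a maximal torus of `G`. The root system of `(G, T)` is `R`"*):

* `isMaximalTorusIn_T`: **`T = T_X` is a maximal torus of `G`** — a torus `T' ⊇ T` in `G` is
  commutative, so `Lie(T')` centralises `T` (`mul_eq_mul_of_mem_lieAlgebraGL`), i.e. consists of
  degree-`0` elements of `Lie(G)`, which lie in `𝔱_V = Lie(T)` (`mem_torusLie_of_isHomogMat_zero`);
  connected groups with the same Lie algebra coincide (Springer 4.4.6 / `eq_of_le_of_lieAlgebraGL_eq`).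
* `isReductiveSubgroup_G`: **`G` is reductive** — a normal unipotent subgroup `U` of `G` has, in
  each block `V_j`, a non-zero space of fixed vectors (Kolchin, `BurnsideKolchin.lean`), stable
  under `G` (normality) hence under `Lie(G) ∋ E_α, D_ℓ`, hence all of `V_j` (irreducibility of the
  blocks): `U` is trivial.
* `image_roots_eq`: **the roots of `(G, T)` are exactly `R`** — `α ∈ R` is a root through the
  root homomorphism `x ↦ exp (x E_α)` (`mem_roots_of_expHom`), and a root of `(G, T)` is a
  non-zero `T`-weight on `Lie(G) = 𝔤_V` (`roots_subset_lieWeights`), whose non-zero degrees are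
  the roots.
* `isConnectedReductive_G`.

## References

* [SpringerLAG1998] T. A. Springer, *Linear Algebraic Groups*, 2nd ed. (1998): 2.4.12, 4.4.6,
  7.1.1, 8.1.1, 10.1.1, 10.2.8.
-/

noncomputable section

open scoped MatrixGroups

namespace Literature.NumberTheory.Automorphic

attribute [local instance 100] LieRing.ofAssociativeRing

variable {k : Type*} [Field k]

/-! ### The Lie algebra of a subgroup centralising a matrix -/

section Centralize

variable {n : Type*} [Fintype n] [DecidableEq n]

/-- The linear polynomial `(x M - M x)_{a c}` in the coordinates of `GL n`. [folklore] -/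
def commPoly (M : Matrix n n k) (a c : n) : MvPolynomial (GLCoord n) k :=
  ∑ e, (MvPolynomial.X (Sum.inl (a, e)) * MvPolynomial.C (M e c) -
    MvPolynomial.C (M a e) * MvPolynomial.X (Sum.inl (e, c)))

/-- Evaluation of `commPoly`. [folklore] -/
lemma eval_commPoly (M : Matrix n n k) (a c : n) (g : GL n k) :
    MvPolynomial.eval (glCoordFun g) (commPoly M a c) = ((g : Matrix n n k) * M - M * g) a c := by
  simp [commPoly, Matrix.mul_apply, Finset.sum_sub_distrib]

/-- The differential of `commPoly` at `1` is `(A M - M A)_{a c}`. [folklore] -/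
lemma tangentDeriv_commPoly (M : Matrix n n k) (a c : n) (A : Matrix n n k) :
    tangentDeriv (commPoly M a c) A = (A * M - M * A) a c := by
  rw [commPoly, tangentDeriv_sum]
  simp only [tangentDeriv_sub, tangentDeriv_C_mul, tangentDeriv_X, Matrix.sub_apply,
    Matrix.mul_apply, Finset.sum_sub_distrib]
  congr 1
  refine Finset.sum_congr rfl fun e _ => ?_
  rw [mul_comm (MvPolynomial.X _), tangentDeriv_C_mul, tangentDeriv_X]
  simp [tangentCoord, mul_comm]

/-- **The Lie algebra of a subgroup commuting with `M` commutes with `M`** (the differentials of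
the linear equations `g M = M g`). [folklore] -/
theorem mul_eq_mul_of_mem_lieAlgebraGL {H : Subgroup (GL n k)} {M : Matrix n n k}
    (hH : ∀ g ∈ H, (g : Matrix n n k) * M = M * g) {A : Matrix n n k} (hA : A ∈ lieAlgebraGL H) :
    A * M = M * A := by
  rw [mem_lieAlgebraGL_iff] at hA
  rw [← sub_eq_zero]
  ext a c
  have hmem : commPoly M a c ∈ MvPolynomial.vanishingIdeal k
      (glCoordFun '' ((H : Subgroup (GL n k)) : Set (GL n k))) := by
    rw [MvPolynomial.mem_vanishingIdeal_iff]
    rintro _ ⟨g, hg, rfl⟩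
    change MvPolynomial.eval (glCoordFun g) (commPoly M a c) = 0
    rw [eval_commPoly, hH g hg, sub_self, Matrix.zero_apply]
  have h := hA _ hmem
  rwa [tangentDeriv_commPoly] at h

end Centralize

variable {ι X Y : Type*} [AddCommGroup X] [AddCommGroup Y]
variable {J : Type*} [Fintype J] [DecidableEq J] {mb : J → Type*} [∀ j, Fintype (mb j)]
  [∀ j, DecidableEq (mb j)]
variable {P : RootPairing ι ℤ X Y} {b : P.Base}

namespace RootRep

variable (D : RootRep k P b J mb)

local notation "𝕄" => Matrix (Σ j, mb j) (Σ j, mb j) k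

/-! ### `T_X` is a maximal torus of `G` -/

/-- **A matrix commuting with `T_X` is homogeneous of degree `0`** (characters of the free lattice
`X` separate the degrees). [folklore] -/
theorem isHomogMat_zero_of_forall_commute [Infinite k] [Module.Free ℤ X] [Module.Finite ℤ X]
    {A : 𝕄} (hA : ∀ t ∈ D.T, A * (t : 𝕄) = (t : 𝕄) * A) : IsHomogMat D.wt 0 A := by
  intro a c hac
  rw [add_zero]
  by_contra hne
  obtain ⟨ψ, hψ⟩ := exists_char_apply_ne_one (k := k) (sub_ne_zero.2 hne)
  have h := hA _ ⟨ψ, rfl⟩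
  rw [weightTorusHom_apply, coe_diagonalGL] at h
  have h' := congrFun (congrFun h a) c
  rw [Matrix.mul_diagonal, Matrix.diagonal_mul, mul_comm] at h'
  have h'' := mul_right_cancel₀ hac h'
  apply hψ
  rw [ofAdd_sub, map_div, div_eq_one]
  exact Units.val_injective h''.symm

/-- **`T_X` is a maximal torus of `G`** (Springer 10.2.8 via 5.4.7; here: `Lie` of a torus
`T' ⊇ T` in `G` consists of degree-`0` elements of `Lie(G)`, which form `𝔱_V = Lie(T)`).
[cite: SpringerLAG1998, Prop 10.2.8] -/
theorem isMaximalTorusIn_T [IsAlgClosed k] [CharZero k] [Finite ι] [Module.Free ℤ X]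
    [Module.Finite ℤ X] : IsMaximalTorusIn D.T D.G := by
  refine ⟨D.T_le_G, D.isTorusSubgroup_T, fun T' hTT' hT'G hT' => ?_⟩
  -- `Lie(T') ≤ 𝔱_V = Lie(T)`
  have hle : lieAlgebraGL T' ≤ lieAlgebraGL D.T := by
    intro A hA
    have hcomm : ∀ t ∈ D.T, A * (t : 𝕄) = (t : 𝕄) * A := by
      intro t ht
      refine mul_eq_mul_of_mem_lieAlgebraGL (fun g hg => ?_) hA
      have := hT'.2.1.is_comm.comm ⟨g, hg⟩ ⟨t, hTT' ht⟩
      simpa using congrArg (fun x : ↥T' => ((x : GL (Σ j, mb j) k) : 𝕄)) this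
    have h0 := D.isHomogMat_zero_of_forall_commute hcomm
    rw [D.T_def, lieAlgebraGL_weightTorus_eq D.wt_surjective]
    exact D.mem_torusLie_of_isHomogMat_zero (lieAlgebraGL_mono hT'G hA) h0
  exact (D.isZConnected_T.eq_of_le_of_lieAlgebraGL_eq hT'.1 hTT'
    (le_antisymm (lieAlgebraGL_mono hTT') hle)).symm

/-! ### `G` is reductive -/

section Reductive

variable [CharZero k]

/-- The representation of `G` on the block `V_j` (elements of `G` are block diagonal).
[folklore] -/
def blockEnd (j : J) : ↥D.G →* Module.End k (mb j → k) where
  toFun g := Matrix.toLin' (Matrix.blockDiag' ((g : GL (Σ j, mb j) k) : 𝕄) j)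
  map_one' := by
    rw [OneMemClass.coe_one, Units.val_one, Matrix.blockDiag'_one, Pi.one_apply, Matrix.toLin'_one]
    rfl
  map_mul' g h := by
    rw [Subgroup.coe_mul, Units.val_mul,
      IsBlockDiag.blockDiag'_mul (D.G_le_blockDiagSubgroup g.2).1 (D.G_le_blockDiagSubgroup h.2).1,
      Matrix.toLin'_mul]
    rfl

/-- Unfolding of `blockEnd`. [folklore] -/
lemma blockEnd_apply (j : J) (g : ↥D.G) :
    D.blockEnd j g = Matrix.toLin' (Matrix.blockDiag' ((g : GL (Σ j, mb j) k) : 𝕄) j) := rfl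

omit [CharZero k] in
/-- Powers of block-diagonal matrices, block by block. [folklore] -/
lemma IsBlockDiag.blockDiag'_pow {M : 𝕄} (hM : IsBlockDiag M) (j : J) (r : ℕ) :
    Matrix.blockDiag' (M ^ r) j = Matrix.blockDiag' M j ^ r := by
  induction r with
  | zero => rw [pow_zero, pow_zero, Matrix.blockDiag'_one, Pi.one_apply]
  | succ r ih =>
    have hMr : IsBlockDiag (M ^ r) := by
      clear ih
      induction r with
      | zero =>
        intro x y h
        rw [pow_zero, Matrix.one_apply_ne (fun hxy => h (congrArg Sigma.fst hxy))]
      | succ r ih' => rw [pow_succ]; exact ih'.mul hM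
    rw [pow_succ, pow_succ, IsBlockDiag.blockDiag'_mul hMr hM, ih]

/-- A unipotent element of `G` acts unipotently on each block. [folklore] -/
lemma isNilpotent_blockEnd_sub_one (j : J) {g : ↥D.G}
    (hg : IsUnipotentElt (g : GL (Σ j, mb j) k)) : IsNilpotent (D.blockEnd j g - 1) := by
  obtain ⟨r, hr⟩ := hg
  have hbd : IsBlockDiag (((g : GL (Σ j, mb j) k) : 𝕄) - 1) := by
    intro x y h
    rw [Matrix.sub_apply, (D.G_le_blockDiagSubgroup g.2).1 x y h,
      Matrix.one_apply_ne (fun hxy => h (congrArg Sigma.fst hxy)), sub_zero]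
  refine ⟨r, ?_⟩
  have h1 : D.blockEnd j g - 1 = Matrix.toLin' (Matrix.blockDiag' (((g : GL (Σ j, mb j) k) : 𝕄) - 1) j) := by
    rw [blockEnd_apply, Matrix.blockDiag'_sub, Pi.sub_apply, Matrix.blockDiag'_one, Pi.one_apply,
      map_sub, Matrix.toLin'_one]
    rfl
  rw [h1]
  change Matrix.toLinAlgEquiv' (Matrix.blockDiag' (((g : GL (Σ j, mb j) k) : 𝕄) - 1) j) ^ r = 0
  rw [← map_pow, ← hbd.blockDiag'_pow, hr, Matrix.blockDiag'_zero, Pi.zero_apply, map_zero]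

/-- The fixed vectors of a subgroup `U ≤ G` in the block `V_j`. [folklore] -/
def blockFixed (U : Subgroup (GL (Σ j, mb j) k)) (j : J) : Submodule k (mb j → k) where
  carrier := {v | ∀ u : ↥D.G, (u : GL (Σ j, mb j) k) ∈ U → D.blockEnd j u v = v}
  zero_mem' u _ := map_zero _
  add_mem' {v w} hv hw u hu := by rw [map_add, hv u hu, hw u hu]
  smul_mem' c {v} hv u hu := by rw [map_smul, hv u hu]

/-- Membership in `blockFixed`. [folklore] -/
lemma mem_blockFixed_iff {U : Subgroup (GL (Σ j, mb j) k)} {j : J} {v : mb j → k} :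
    v ∈ D.blockFixed U j ↔ ∀ u : ↥D.G, (u : GL (Σ j, mb j) k) ∈ U → D.blockEnd j u v = v :=
  Iff.rfl

/-- **Kolchin**: a unipotent subgroup of `G` has non-zero fixed vectors in every block.
[cite: SpringerLAG1998, 2.4.12] -/
theorem blockFixed_ne_bot [IsAlgClosed k] {U : Subgroup (GL (Σ j, mb j) k)}
    (hU : IsUnipotentSubgroup U) (j : J) : D.blockFixed U j ≠ ⊥ := by
  obtain ⟨a, -⟩ := D.exists_wt_eq_hw j
  haveI : Nontrivial (mb j → k) := ⟨⟨Pi.single a (1 : k), 0, fun h => by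
    have h1 : (1 : k) = 0 := by simpa using congrFun h a
    exact one_ne_zero h1⟩⟩
  let S : Submonoid (Module.End k (mb j → k)) := (U.subgroupOf D.G).toSubmonoid.map (D.blockEnd j)
  have hS : ∀ s ∈ S, IsNilpotent (s - 1) := by
    rintro _ ⟨u, hu, rfl⟩
    exact D.isNilpotent_blockEnd_sub_one j (hU _ (Subgroup.mem_subgroupOf.1 hu))
  obtain ⟨v, hv0, hv⟩ := exists_ne_zero_forall_apply_eq_of_isNilpotent S hS
  rw [Submodule.ne_bot_iff]
  exact ⟨v, fun u hu => hv _ ⟨u, Subgroup.mem_subgroupOf.2 hu, rfl⟩, hv0⟩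

/-- The fixed vectors of a subgroup normal in `G` are stable under `G`. [folklore] -/
lemma blockEnd_mem_blockFixed {U : Subgroup (GL (Σ j, mb j) k)} (hN : (U.subgroupOf D.G).Normal)
    {j : J} (g : ↥D.G) {v : mb j → k} (hv : v ∈ D.blockFixed U j) :
    D.blockEnd j g v ∈ D.blockFixed U j := by
  intro u hu
  have hconj : ((g⁻¹ * u * g : ↥D.G) : GL (Σ j, mb j) k) ∈ U := by
    have h := hN.conj_mem u (Subgroup.mem_subgroupOf.2 hu) g⁻¹
    rw [inv_inv] at h
    exact Subgroup.mem_subgroupOf.1 h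
  have hug : u * g = g * (g⁻¹ * u * g) := by group
  rw [← Module.End.mul_apply, ← map_mul, hug, map_mul, Module.End.mul_apply, hv _ hconj]

/-- The vector of `V = ⊕ V_j` supported in block `j` with block component `v`. [folklore] -/
def blockVec (j : J) (v : mb j → k) : (Σ j, mb j) → k :=
  fun x => if h : x.1 = j then v (h ▸ x.2) else 0

omit [Fintype J] [∀ j, Fintype (mb j)] [∀ j, DecidableEq (mb j)] [CharZero k] in
/-- `blockVec` on its block. [folklore] -/
@[simp] lemma blockVec_apply_mk (j : J) (v : mb j → k) (a : mb j) : blockVec j v ⟨j, a⟩ = v a := by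
  simp [blockVec]

omit [Fintype J] [∀ j, Fintype (mb j)] [∀ j, DecidableEq (mb j)] [CharZero k] in
/-- `blockVec` vanishes off its block. [folklore] -/
lemma blockVec_apply_of_ne (j : J) (v : mb j → k) {x : Σ j, mb j} (h : x.1 ≠ j) :
    blockVec j v x = 0 := by
  simp [blockVec, h]

omit [Fintype J] [∀ j, Fintype (mb j)] [∀ j, DecidableEq (mb j)] [CharZero k] in
/-- `blockVec` is injective. [folklore] -/
lemma blockVec_injective (j : J) : Function.Injective (blockVec (k := k) (mb := mb) j) := by
  intro v w h
  funext a
  simpa using congrFun h ⟨j, a⟩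

/-- `blockVec` as a linear map. [folklore] -/
def blockVecLin (j : J) : (mb j → k) →ₗ[k] ((Σ j, mb j) → k) where
  toFun := blockVec j
  map_add' v w := by
    funext x
    by_cases h : x.1 = j
    · rcases x with ⟨j', a⟩; cases h; simp
    · simp [blockVec_apply_of_ne _ _ h]
  map_smul' c v := by
    funext x
    by_cases h : x.1 = j
    · rcases x with ⟨j', a⟩; cases h; simp
    · simp [blockVec_apply_of_ne _ _ h]

omit [Fintype J] [∀ j, Fintype (mb j)] [∀ j, DecidableEq (mb j)] [CharZero k] in
/-- Unfolding of `blockVecLin`. [folklore] -/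
@[simp] lemma blockVecLin_apply (j : J) (v : mb j → k) :
    blockVecLin (k := k) j v = blockVec j v := rfl

omit [∀ j, DecidableEq (mb j)] [CharZero k] in
/-- **A block-diagonal matrix acts on vectors supported in a block through its diagonal block.**
[folklore] -/
lemma IsBlockDiag.mulVec_blockVec {M : 𝕄} (hM : IsBlockDiag M) (j : J) (v : mb j → k) :
    M.mulVec (blockVec j v) = blockVec j ((Matrix.blockDiag' M j).mulVec v) := by
  funext x
  rw [Matrix.mulVec, dotProduct, Fintype.sum_sigma,
    Finset.sum_eq_single_of_mem j (Finset.mem_univ j) (fun j' _ hj' =>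
      Finset.sum_eq_zero fun c _ => by rw [blockVec_apply_of_ne _ _ (by exact hj'), mul_zero])]
  by_cases h : x.1 = j
  · rcases x with ⟨j', a⟩
    cases h
    simp [Matrix.mulVec, dotProduct, Matrix.blockDiag'_apply]
  · rw [blockVec_apply_of_ne _ _ h]
    refine Finset.sum_eq_zero fun c _ => ?_
    rw [hM x ⟨j, c⟩ h, zero_mul]

/-- **The fixed vectors of a normal subgroup are stable under `Lie(G)`, block by block** (they are
stable under `G`, and `Lie(G)` preserves `G`-stable subspaces, Springer 4.4.15). [folklore] -/
theorem mulVec_mem_blockFixed_of_mem_lieAlgebraGL {U : Subgroup (GL (Σ j, mb j) k)}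
    (hN : (U.subgroupOf D.G).Normal) {j : J} {A : 𝕄} (hA : A ∈ lieAlgebraGL D.G)
    {v : mb j → k} (hv : v ∈ D.blockFixed U j) :
    (Matrix.blockDiag' A j).mulVec v ∈ D.blockFixed U j := by
  -- the lifted subspace of `V` and its `G`-stability
  let W : Submodule k ((Σ j, mb j) → k) := (D.blockFixed U j).map (blockVecLin j)
  have hW : ∀ g ∈ D.G, ∀ w ∈ W, (g : 𝕄).mulVec w ∈ W := by
    rintro g hg _ ⟨v', hv', rfl⟩
    rw [blockVecLin_apply, IsBlockDiag.mulVec_blockVec (D.G_le_blockDiagSubgroup hg).1]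
    exact ⟨_, D.blockEnd_mem_blockFixed hN ⟨g, hg⟩ hv', rfl⟩
  have h := mulVec_mem_of_forall_mulVec_mem hW hA ⟨v, hv, rfl⟩
  rw [blockVecLin_apply, IsBlockDiag.mulVec_blockVec (D.isBlockDiag_of_mem_lieAlgebraGL hA)] at h
  obtain ⟨v'', hv'', h''⟩ := h
  rw [blockVecLin_apply] at h''
  rwa [← blockVec_injective j h'']

/-- **The fixed vectors of a normal unipotent subgroup fill each block** (irreducibility of the
blocks under the root matrices and `𝔱_V`, which lie in `Lie(G)`). [folklore] -/
theorem blockFixed_eq_top [IsAlgClosed k] [Module.Free ℤ X] [Module.Finite ℤ X]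
    {U : Subgroup (GL (Σ j, mb j) k)} (hN : (U.subgroupOf D.G).Normal)
    (hU : IsUnipotentSubgroup U) (j : J) : D.blockFixed U j = ⊤ := by
  have hE' : ∀ i, ∀ v ∈ D.blockFixed U j, ((D.blk j).E i).mulVec v ∈ D.blockFixed U j := by
    intro i v hv
    have h := D.mulVec_mem_blockFixed_of_mem_lieAlgebraGL hN (D.E_mem_lieAlgebraGL i) hv
    simpa only [RootRep.E, sigmaE, Matrix.blockDiag'_blockDiagonal'] using h
  have hT' : ∀ ℓ : X →+ k, ∀ v ∈ D.blockFixed U j,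
      (torusDiag (D.blk j).wt ℓ).mulVec v ∈ D.blockFixed U j := by
    intro ℓ v hv
    have h := D.mulVec_mem_blockFixed_of_mem_lieAlgebraGL hN
      (D.torusLie_le_lieAlgebraGL (torusDiag_mem_torusLie ℓ)) hv
    rwa [D.torusDiag_eq_blockDiagonal', Matrix.blockDiag'_blockDiagonal'] at h
  rcases (D.blk j).irreducible (D.blockFixed U j) hE' hT' with h | h
  · exact (D.blockFixed_ne_bot hU j h).elim
  · exact h

/-- **A normal unipotent subgroup of `G` is trivial.** [folklore] -/
theorem eq_bot_of_normal_of_isUnipotentSubgroup [IsAlgClosed k] [Module.Free ℤ X] [Module.Finite ℤ X]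
    {U : Subgroup (GL (Σ j, mb j) k)} (hUG : U ≤ D.G) (hN : (U.subgroupOf D.G).Normal)
    (hU : IsUnipotentSubgroup U) : U = ⊥ := by
  refine (Subgroup.eq_bot_iff_forall _).2 fun u hu => ?_
  -- `u` acts trivially on every block
  have hblk : ∀ j, Matrix.blockDiag' (u : 𝕄) j = 1 := by
    intro j
    have htop := D.blockFixed_eq_top hN hU j
    have hid : D.blockEnd j ⟨u, hUG hu⟩ = 1 := by
      refine LinearMap.ext fun v => ?_
      have hv : v ∈ D.blockFixed U j := by rw [htop]; exact Submodule.mem_top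
      exact hv _ hu
    rw [blockEnd_apply] at hid
    have := congrArg Matrix.toLin'.symm hid
    rw [LinearEquiv.symm_apply_apply] at this
    rw [this]
    exact Matrix.toLin'.symm_apply_eq.mpr (by rw [Matrix.toLin'_one]; rfl)
  apply Units.ext
  rw [(D.G_le_blockDiagSubgroup (hUG hu)).1.eq_blockDiagonal', Units.val_one]
  rw [show Matrix.blockDiag' (u : 𝕄) = 1 from funext hblk, Matrix.blockDiagonal'_one]

/-- **`G` is reductive** (Springer 10.2.8; here: a normal connected unipotent subgroup fixes a
non-zero, `G`-stable, hence total, subspace of each irreducible block). [cite: SpringerLAG1998, Prop 10.2.8] -/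
theorem isReductiveSubgroup_G [IsAlgClosed k] [Module.Free ℤ X] [Module.Finite ℤ X] :
    IsReductiveSubgroup D.G :=
  ⟨D.isAlgebraicSubgroup_G, fun _ hUG hN _ hU => D.eq_bot_of_normal_of_isUnipotentSubgroup hUG hN hU⟩

/-- **`G` is connected reductive.** [cite: SpringerLAG1998, Prop 10.2.8] -/
theorem isConnectedReductive_G [IsAlgClosed k] [Module.Free ℤ X] [Module.Finite ℤ X] :
    IsConnectedReductive D.G :=
  ⟨D.isZConnected_G, D.isReductiveSubgroup_G⟩

end Reductive

/-! ### The roots of `(G, T)` are the roots of `P` -/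

section Roots

/-- The character of `T = T_X` attached to `x ∈ X`, as an element of the character lattice.
[folklore] -/
abbrev charOf [Module.Free ℤ X] [Module.Finite ℤ X] (x : X) : ↥(characterLattice D.T) :=
  Additive.toMul (evalCharHom k D.wt_surjective x)

/-- The character underlying `charOf x` is `evalChar x`. [folklore] -/
lemma coe_charOf [Module.Free ℤ X] [Module.Finite ℤ X] (x : X) :
    ((D.charOf x : ↥(characterLattice D.T)) : ↥D.T →* kˣ) = evalChar k D.wt_surjective x :=
  coe_toMul_evalCharHom D.wt_surjective x

/-- The character identification `eX : X*(T) ≃ X` of the weight torus. [folklore] -/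
abbrev eX [Infinite k] [Module.Free ℤ X] [Module.Finite ℤ X] : Additive ↥(characterLattice D.T) ≃+ X :=
  charEquiv k D.wt_surjective

/-- `eX (charOf x) = x`. [folklore] -/
lemma eX_charOf [Infinite k] [Module.Free ℤ X] [Module.Finite ℤ X] (x : X) :
    D.eX (Additive.ofMul (D.charOf x)) = x :=
  charEquiv_evalCharHom D.wt_surjective x

/-- The character of a non-zero `x ∈ X` is non-trivial. [folklore] -/
lemma coe_charOf_ne_one [Infinite k] [Module.Free ℤ X] [Module.Finite ℤ X] {x : X} (hx : x ≠ 0) :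
    ((D.charOf x : ↥(characterLattice D.T)) : ↥D.T →* kˣ) ≠ 1 := by
  intro h
  apply hx
  apply evalCharHom_injective (k := k) D.wt_surjective
  rw [map_zero]
  apply Additive.toMul.injective
  exact Subtype.ext h

/-- **Every root of `P` is a root of `(G, T)`** (through the root homomorphism `x ↦ exp (x E_α)`).
[cite: SpringerLAG1998, Prop 10.2.8] -/
theorem charOf_root_mem_roots [CharZero k] [Infinite k] [Module.Free ℤ X] [Module.Finite ℤ X]
    (i : ι) :
    D.charOf (P.root i) ∈ roots D.G D.T :=
  mem_roots_of_expHom D.T_le_G (D.isNilpotent_E i) (D.E_ne_zero i) (D.expHom_mem_G i)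
    (D.coe_charOf_ne_one (P.ne_zero i)) (fun t => by rw [coe_charOf]; exact D.conj_E i t)

/-- **Every root of `(G, T)` is a root of `P`** (a root is a non-zero `T`-weight of
`Lie(G) = 𝔱_V + ∑ k E_α`, whose non-zero degrees are the roots).
[cite: SpringerLAG1998, Prop 10.2.8] -/
theorem exists_charOf_root_eq [CharZero k] [IsAlgClosed k] [Finite ι] [Module.Free ℤ X]
    [Module.Finite ℤ X] {α : ↥(characterLattice D.T)} (hα : α ∈ roots D.G D.T) :
    ∃ i, D.charOf (P.root i) = α := by
  cases nonempty_fintype ι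
  obtain ⟨hα1, hαw⟩ := roots_subset_lieWeights hα
  obtain ⟨A, ⟨hAL, hAw⟩, hA0⟩ := (Submodule.ne_bot_iff _).1 hαw
  -- `A` is homogeneous, of degree `ξ` say, and `α = evalChar ξ`
  obtain ⟨ξ, hξ⟩ := D.exists_isHomogMat_of_mem_weightSpaceGL hAw
  have hαξ : (α : ↥D.T →* kˣ) = evalChar k D.wt_surjective ξ := by
    refine MonoidHom.ext fun t => ?_
    have h1 := hAw t
    have h2 := D.conj_of_isHomogMat t hξ
    rw [Matrix.coe_units_inv] at h2
    rw [h1] at h2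
    obtain ⟨a, c, hac⟩ : ∃ a c, A a c ≠ 0 := by
      by_contra hcon; push Not at hcon
      exact hA0 (Matrix.ext fun a c => by rw [hcon a c]; rfl)
    have h3 := congrFun (congrFun h2 a) c
    simp only [Matrix.smul_apply, smul_eq_mul] at h3
    exact Units.val_injective (mul_right_cancel₀ hac h3)
  -- `ξ ≠ 0`
  have hξ0 : ξ ≠ 0 := by
    rintro rfl
    apply hα1
    rw [hαξ]
    refine MonoidHom.ext fun t => ?_
    rw [evalChar_apply, ofAdd_zero, map_one]
    rfl
  -- `A ∈ 𝔤_V` homogeneous of degree `ξ ≠ 0`: `ξ` is a root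
  have hAlie : A ∈ D.lie := by rw [← D.lieAlgebraGL_G_eq]; exact hAL
  obtain ⟨D₀, hD₀, S, hS, rfl⟩ := Submodule.mem_sup.1 hAlie
  obtain ⟨ℓ, rfl⟩ := hD₀
  obtain ⟨c, rfl⟩ := (Submodule.mem_span_range_iff_exists_fun k).1 hS
  have hi : ∃ i, P.root i = ξ := by
    by_contra hcon
    push Not at hcon
    apply hA0
    rw [← hξ.homogComp_eq_self, homogComp_add, torusDiagLin_apply,
      (isHomogMat_torusDiag ℓ).homogComp_eq_zero (Ne.symm hξ0), zero_add, homogComp_sum]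
    refine Finset.sum_eq_zero fun i _ => ?_
    rw [homogComp_smul, (D.isHomogMat_E i).homogComp_eq_zero (hcon i), smul_zero]
  obtain ⟨i, rfl⟩ := hi
  exact ⟨i, Subtype.ext (by rw [coe_charOf, hαξ])⟩

/-- **The roots of `(G, T)` are the roots of `P`** under `eX : X*(T) ≃ X` (the clause `range_root`
of `IsRootDatumOf`). [cite: SpringerLAG1998, Prop 10.2.8] -/
theorem range_root_eq_image_roots [CharZero k] [IsAlgClosed k] [Finite ι] [Module.Free ℤ X]
    [Module.Finite ℤ X] :
    Set.range P.root = (fun α => D.eX (Additive.ofMul α)) '' roots D.G D.T := by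
  ext x
  constructor
  · rintro ⟨i, rfl⟩
    exact ⟨D.charOf (P.root i), D.charOf_root_mem_roots i, D.eX_charOf _⟩
  · rintro ⟨α, hα, rfl⟩
    obtain ⟨i, rfl⟩ := D.exists_charOf_root_eq hα
    exact ⟨i, (D.eX_charOf _).symm⟩

end Roots

end RootRep

end Literature.NumberTheory.Automorphic
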